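import Summits.AtomisticToContinuum.Crystallization.Theorems.ContactSaturationLadderCoveringRung

/-!
# ContactSaturationLadderCoveringRungSharp — the Fejes Tóth covering rung pushed to the METHOD'S CEILING:
# `NoLooseChunksF (27/10)` (and the three-decimal `539/200`) modulo the one cited fact (helper, supports item 30303;
# lens-1 g34 §46 `CoveringRung46`, kernels only; executes critic row 444 (B) «extend the CoveringRung down … state the exact endpoint»)

THE ENDPOINT THE FT FORMULA YIELDS (numbers): with `ω₁₁ = 11π/54` the Fejes Tóth covering angle is
`θ_FT = arccos (cot ω₁₁ / √3) = 39.148°`; eleven unit balls `1`-cover `S(c, ρ)` only if `arcsin (1/ρ) ≥ θ₁₁ ≥ θ_FT`, so the covering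
reduction gives `BallCoveringBound 11 ρ` exactly for `ρ > ρ_FT := 1 / sin θ_FT = 1.58396…` — equivalently `cos² ω₁₁ < 3(ρ²−1)/(4ρ²−3)` — and the
rung `NoLooseChunksF δ` for `(1+δ)·(7/10) ≥ 1 + ρ`, i.e. down to the IRRATIONAL ceiling `δ_FT = (1 + ρ_FT)/(7/10) − 1 = 2.6914…`; the value
`2.69` itself is NOT reachable by the method (`2.69 < δ_FT`).  Typed here: the PARAMETRIC form `ballCoveringBound_eleven_of_sq :
2513/1000 ≤ ρ² → BallCoveringBound 11 ρ` (from `cos ω₁₁ ≤ 0.8022`, four-decimal `π`), the rung of record `NoLooseChunksF (27/10)`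
(`ρ = 159/100`, `(1 + 27/10)·(7/10) = 1 + 159/100` EXACTLY) and the sharpest three-decimal rung `NoLooseChunksF (539/200)` (`ρ = 3173/2000`,
`(1 + 539/200)·(7/10) = 1 + 3173/2000` EXACTLY); modulo the fact the top piece of the ladder is `BandExclusionF 2 (27/10)`
(`noLooseChunksF_two_iff_band27_of_sphereCovering`), and `BandExclusionF 2 (11/4) ↔ BandExclusionF 2 (27/10)`.

No `def`, no `instance`, no `notation`, no `axiom`, no `sorry`.  Imports only the landed `…Theorems.ContactSaturationLadderCoveringRung` (p821393).
-/

noncomputable section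

namespace Summit.AtomisticToContinuum.Crystallization.Theorems.ContactSaturationLadderCoveringRungSharp

open scoped BigOperators Classical
open Metric Set
open Literature.Geometry.DiscreteGeometry (sphCap FejesToth1943_sphereCovering)
open Summit.AtomisticToContinuum.Crystallization.Theorems.ContactSaturationLadderToleranceFloor (NoLooseChunksF BandExclusionF
  bandExclusionF_of_noLooseChunksF noLooseChunksF_iff_band noLooseChunksF_mono)
open Summit.AtomisticToContinuum.Crystallization.Theorems.ContactSaturationLadderGeometricTop (BallCoveringBound
  noLooseChunksF_of_ballCoveringBound)
open Summit.AtomisticToContinuum.Crystallization.Theorems.ContactSaturationLadderAreaTop (angle_le_arccos_of_dist_lt_one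
  ballCoveringBound_mono noLooseChunksF_areaTop)
open Summit.AtomisticToContinuum.Crystallization.Theorems.ContactSaturationLadderCoveringRung (sin_omega_eleven_pos
  cos_omega_eleven_nonneg cover_family_of_finset noLooseChunksF_2p75_of_sphereCovering noLooseChunksF_two_iff_band_of_sphereCovering)

/-! ### §46.1 Sharper numerics at `ω₁₁ = 11π/54`: `cos ω₁₁ ≤ 0.8022` (true value `0.802123…`) -/

/-- `cos (11π/54) ≤ 8022/10000`: `cos 2y = 1 − 2 sin² y` with `y = 11π/108 ∈ [0.319967, 0.31998]` (four-decimal `π`) and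
`sin y ≥ y − y³/6 ≥ 0.3145`. -/
theorem cos_omega_eleven_le' : Real.cos (11 * Real.pi / 54) ≤ 8022 / 10000 := by
  have hy : 11 * Real.pi / 54 = 2 * (11 * Real.pi / 108) := by ring
  rw [hy, Real.cos_two_mul]
  set y : ℝ := 11 * Real.pi / 108 with hydef
  have hpi1 := Real.pi_gt_d4
  have hpi2 := Real.pi_lt_d4
  have hy0 : (319967 : ℝ) / 1000000 ≤ y := by rw [hydef]; linarith
  have hy1 : y ≤ (31998 : ℝ) / 100000 := by rw [hydef]; linarith
  have hy3 : y ^ 3 ≤ ((31998 : ℝ) / 100000) ^ 3 := pow_le_pow_left₀ (by linarith) hy1 3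
  have hL : (3145 : ℝ) / 10000 ≤ y - y ^ 3 / 6 := by nlinarith
  have hsin : (3145 : ℝ) / 10000 ≤ Real.sin y := hL.trans (Real.sin_ge_sub_cube (by linarith))
  have hpyth := Real.sin_sq_add_cos_sq y
  nlinarith [mul_le_mul hsin hsin (by norm_num) ((show (0:ℝ) ≤ 3145 / 10000 by norm_num).trans hsin)]

/-! ### §46.2 ★ The PARAMETRIC covering rung: `FejesToth1943_sphereCovering → 2513/1000 ≤ ρ² → BallCoveringBound 11 ρ` -/

/-- **THE COVERING RUNG AT THE METHOD'S CEILING (parametric).**  Under L. Fejes Tóth's sphere-covering theorem, eleven points never come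
within `< 1` of every point of a sphere of radius `ρ` with `ρ² ≥ 2.513` (`ρ ≥ 1.5853`; the exact ceiling of the method is `ρ_FT = 1.58396…`):
otherwise the eleven caps of angular radius `arccos (√(ρ²−1)/ρ)` about their directions cover `S²`, so Fejes Tóth gives
`3 (ρ² − 1) sin² ω₁₁ ≤ ρ² cos² ω₁₁`, i.e. `cos² ω₁₁ ≥ 3(ρ²−1)/(4ρ²−3) ≥ 0.64365`, against `cos ω₁₁ ≤ 0.8022` (`0.8022² = 0.64352`). -/
theorem ballCoveringBound_eleven_of_sq (hFT : FejesToth1943_sphereCovering) {ρ : ℝ} (hρsq : 2513 / 1000 ≤ ρ ^ 2) (hρ0 : 0 < ρ) :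
    BallCoveringBound 11 ρ := by
  intro c Z hZ
  by_contra hcon
  push Not at hcon
  have hρ : (1 : ℝ) ≤ ρ := by nlinarith
  have hρne : ρ ≠ 0 := hρ0.ne'
  set t : ℝ := Real.sqrt (ρ ^ 2 - 1) / ρ with ht
  have hs : Real.sqrt (ρ ^ 2 - 1) ^ 2 = ρ ^ 2 - 1 := Real.sq_sqrt (by nlinarith)
  have ht2 : t ^ 2 = (ρ ^ 2 - 1) / ρ ^ 2 := by rw [ht, div_pow, hs]
  have ht0 : 0 ≤ t := div_nonneg (Real.sqrt_nonneg _) hρ0.le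
  have ht2le : t ^ 2 ≤ 1 := by
    rw [ht2]; exact div_le_one_of_le₀ (by linarith) (sq_nonneg ρ)
  have ht1 : t ≤ 1 := (pow_le_one_iff_of_nonneg ht0 two_ne_zero).1 ht2le
  have hcos : Real.cos (Real.arccos t) = t := Real.cos_arccos (by linarith) ht1
  -- the blocking points off the centre, and the cover of `S²` by the caps about their directions
  set Z' : Finset (EuclideanSpace ℝ (Fin 3)) := Z.filter (fun z => z ≠ c) with hZ'
  let f : EuclideanSpace ℝ (Fin 3) → EuclideanSpace ℝ (Fin 3) := fun z => ‖z - c‖⁻¹ • (z - c)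
  have hcover : {x : EuclideanSpace ℝ (Fin 3) | ‖x‖ = 1} ⊆ ⋃ z ∈ Z', sphCap (f z) (Real.arccos t) := by
    intro u hu
    have hu' : ‖u‖ = 1 := hu
    obtain ⟨z, hz, hd⟩ := hcon (c + ρ • u) (by
      rw [dist_eq_norm, add_sub_cancel_left, norm_smul, Real.norm_eq_abs, abs_of_pos hρ0, hu', mul_one])
    obtain ⟨hw0, hang⟩ := angle_le_arccos_of_dist_lt_one hρ hu' hd
    have hzc : z ≠ c := fun hzc => hw0 (by rw [hzc, sub_self])
    refine mem_iUnion₂.2 ⟨z, Finset.mem_filter.2 ⟨hz, hzc⟩, hu', ?_⟩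
    show InnerProductGeometry.angle (‖z - c‖⁻¹ • (z - c)) u ≤ Real.arccos t
    rw [InnerProductGeometry.angle_smul_left_of_pos _ _ (inv_pos.2 (norm_pos_iff.2 hw0))]
    exact hang
  -- `Z'` is nonempty: the point `c + ρ e₀` of the sphere is blocked by somebody
  have hne : Z'.Nonempty := by
    set u₀ : EuclideanSpace ℝ (Fin 3) := EuclideanSpace.single (0 : Fin 3) (1 : ℝ) with hu₀
    have hu₀n : ‖u₀‖ = 1 := by simp [hu₀]
    obtain ⟨z, hz, hd⟩ := hcon (c + ρ • u₀) (by
      rw [dist_eq_norm, add_sub_cancel_left, norm_smul, Real.norm_eq_abs, abs_of_pos hρ0, hu₀n, mul_one])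
    obtain ⟨hw0, -⟩ := angle_le_arccos_of_dist_lt_one hρ hu₀n hd
    exact ⟨z, Finset.mem_filter.2 ⟨hz, fun hzc => hw0 (by rw [hzc, sub_self])⟩⟩
  have hcard : Z'.card ≤ 11 := (Finset.card_filter_le _ _).trans hZ
  obtain ⟨a, ha, hsub⟩ := cover_family_of_finset hcard hne f (Real.arccos t)
  have ha1 : ∀ i, ‖a i‖ = 1 := by
    intro i
    obtain ⟨z, hz, hai⟩ := ha i
    have hw0 : z - c ≠ 0 := sub_ne_zero.2 (Finset.mem_filter.1 hz).2
    rw [hai]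
    show ‖‖z - c‖⁻¹ • (z - c)‖ = 1
    rw [norm_smul, norm_inv, norm_norm, inv_mul_cancel₀ (norm_ne_zero_iff.2 hw0)]
  -- Fejes Tóth: `cos (arccos t) = t ≤ cot ω₁₁ / √3`
  have hFT' := FejesToth1943_sphereCovering.cos_le hFT (n := 11) (by norm_num) (Real.arccos_nonneg t)
    (Real.arccos_le_pi t) ha1 (hcover.trans hsub)
  rw [hcos] at hFT'
  have hω : ((11 : ℕ) : ℝ) * Real.pi / (6 * (((11 : ℕ) : ℝ) - 2)) = 11 * Real.pi / 54 := by
    push_cast; ring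
  rw [hω, Real.cot_eq_cos_div_sin] at hFT'
  set co := Real.cos (11 * Real.pi / 54) with hco
  set si := Real.sin (11 * Real.pi / 54) with hsi
  have hsi0 : 0 < si := sin_omega_eleven_pos
  have hco0 : 0 ≤ co := cos_omega_eleven_nonneg
  have hco1 : co ≤ 8022 / 10000 := cos_omega_eleven_le'
  have hpyth : si ^ 2 + co ^ 2 = 1 := Real.sin_sq_add_cos_sq _
  have h3 : (0 : ℝ) < Real.sqrt 3 := Real.sqrt_pos.2 (by norm_num)
  have hs3 : Real.sqrt 3 ^ 2 = 3 := Real.sq_sqrt (by norm_num)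
  -- `t · √3 · sin ω ≤ cos ω`
  have h1 : t * Real.sqrt 3 * si ≤ co := by
    have := (le_div_iff₀ h3).1 hFT'
    exact (le_div_iff₀ hsi0).1 this
  have h2 : (t * Real.sqrt 3 * si) ^ 2 ≤ co ^ 2 := pow_le_pow_left₀ (by positivity) h1 2
  have h2' : t ^ 2 * 3 * si ^ 2 ≤ co ^ 2 := by
    calc t ^ 2 * 3 * si ^ 2 = (t * Real.sqrt 3 * si) ^ 2 := by rw [mul_pow, mul_pow, hs3]
      _ ≤ co ^ 2 := h2
  rw [ht2] at h2'
  -- clear the denominator: `3 (ρ² − 1) sin² ω ≤ ρ² cos² ω`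
  have hρ2 : 0 < ρ ^ 2 := by positivity
  have h4 : (ρ ^ 2 - 1) * 3 * si ^ 2 ≤ co ^ 2 * ρ ^ 2 := by
    calc (ρ ^ 2 - 1) * 3 * si ^ 2 = (ρ ^ 2 - 1) / ρ ^ 2 * 3 * si ^ 2 * ρ ^ 2 := by field_simp
      _ ≤ co ^ 2 * ρ ^ 2 := mul_le_mul_of_nonneg_right h2' hρ2.le
  have hsi2 : si ^ 2 = 1 - co ^ 2 := by linarith
  rw [hsi2] at h4
  have hC : co ^ 2 ≤ (8022 / 10000 : ℝ) ^ 2 := pow_le_pow_left₀ hco0 hco1 2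
  nlinarith [mul_nonneg (sub_nonneg.2 hρsq) (sub_nonneg.2 hC), sq_nonneg co]

/-- `BallCoveringBound 11 (159/100)` under the fact (`(159/100)² = 2.5281 ≥ 2.513`). -/
theorem ballCoveringBound_eleven_159 (hFT : FejesToth1943_sphereCovering) : BallCoveringBound 11 (159 / 100) :=
  ballCoveringBound_eleven_of_sq hFT (by norm_num) (by norm_num)

/-- `BallCoveringBound 11 (3173/2000)` under the fact (`ρ = 1.5865`, `ρ² = 2.51698… ≥ 2.513`; within `0.0026` of the ceiling `ρ_FT`). -/
theorem ballCoveringBound_eleven_3173 (hFT : FejesToth1943_sphereCovering) : BallCoveringBound 11 (3173 / 2000) :=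
  ballCoveringBound_eleven_of_sq hFT (by norm_num) (by norm_num)

/-- `BallCoveringBound 11 ρ` for every `ρ ≥ 159/100`, under the fact (radius monotonicity). -/
theorem ballCoveringBound_of_sphereCovering' (hFT : FejesToth1943_sphereCovering) {ρ : ℝ} (hρ : 159 / 100 ≤ ρ) :
    BallCoveringBound 11 ρ :=
  ballCoveringBound_mono (by norm_num) hρ (ballCoveringBound_eleven_159 hFT)

/-! ### §46.3 ★ The rungs: `NoLooseChunksF (27/10)` (of record) and `NoLooseChunksF (539/200)` modulo the ONE cited fact -/

/-- **★ `NoLooseChunksF (27/10)` modulo L. Fejes Tóth's sphere-covering theorem**: the proved-modulo-Literature top of the floor-`7/10`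
ladder drops `11/4 → 27/10` (`(1 + 27/10)·(7/10) = 259/100 = 1 + 159/100` exactly; reduction `noLooseChunksF_of_ballCoveringBound` PROVED in the tree). -/
theorem noLooseChunksF_27_10_of_sphereCovering (hFT : FejesToth1943_sphereCovering) : NoLooseChunksF (27 / 10) :=
  noLooseChunksF_of_ballCoveringBound (ballCoveringBound_eleven_159 hFT) (by norm_num) (by norm_num) (by norm_num)

/-- **`NoLooseChunksF (539/200)` (= 2.695) modulo the fact** — the sharpest three-decimal rung of the covering method
(`(1 + 539/200)·(7/10) = 5173/2000 = 1 + 3173/2000` exactly; the method's ceiling is `δ_FT = 2.6914…`). -/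
theorem noLooseChunksF_2695_of_sphereCovering (hFT : FejesToth1943_sphereCovering) : NoLooseChunksF (539 / 200) :=
  noLooseChunksF_of_ballCoveringBound (ballCoveringBound_eleven_3173 hFT) (by norm_num) (by norm_num) (by norm_num)

/-- Every `NoLooseChunksF δ`, `δ ≥ 539/200`, modulo the fact. -/
theorem noLooseChunksF_of_sphereCovering_ge (hFT : FejesToth1943_sphereCovering) {δ : ℝ} (hδ : 539 / 200 ≤ δ) : NoLooseChunksF δ :=
  noLooseChunksF_mono hδ (noLooseChunksF_2695_of_sphereCovering hFT)

/-- The band `[27/10, δ₂)` of the floor-`7/10` ladder is excluded for every `δ₂`, modulo the fact. -/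
theorem bandExclusionF_27_10_of_sphereCovering (hFT : FejesToth1943_sphereCovering) (δ₂ : ℝ) : BandExclusionF (27 / 10) δ₂ :=
  bandExclusionF_of_noLooseChunksF (noLooseChunksF_27_10_of_sphereCovering hFT)

/-- The band `[539/200, δ₂)` is excluded for every `δ₂`, modulo the fact. -/
theorem bandExclusionF_2695_of_sphereCovering (hFT : FejesToth1943_sphereCovering) (δ₂ : ℝ) : BandExclusionF (539 / 200) δ₂ :=
  bandExclusionF_of_noLooseChunksF (noLooseChunksF_2695_of_sphereCovering hFT)

/-! ### §46.4 The top piece re-based (EXACT modulo the fact): `NLC_F(2) ↔ BAND_F(2, 27/10)`, `BAND_F(2, 11/4) ↔ BAND_F(2, 27/10)` -/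

/-- Modulo the fact, the remaining top piece of the ladder is `BAND_F(2, 27/10)`: `NoLooseChunksF 2 ↔ BandExclusionF 2 (27/10)`. -/
theorem noLooseChunksF_two_iff_band27_of_sphereCovering (hFT : FejesToth1943_sphereCovering) :
    NoLooseChunksF 2 ↔ BandExclusionF 2 (27 / 10) := by
  rw [noLooseChunksF_iff_band (show (2 : ℝ) ≤ 27 / 10 by norm_num)]
  exact ⟨fun h => h.2, fun h => ⟨noLooseChunksF_27_10_of_sphereCovering hFT, h⟩⟩

/-- The three-decimal variant: `NoLooseChunksF 2 ↔ BandExclusionF 2 (539/200)` modulo the fact. -/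
theorem noLooseChunksF_two_iff_band2695_of_sphereCovering (hFT : FejesToth1943_sphereCovering) :
    NoLooseChunksF 2 ↔ BandExclusionF 2 (539 / 200) := by
  rw [noLooseChunksF_iff_band (show (2 : ℝ) ≤ 539 / 200 by norm_num)]
  exact ⟨fun h => h.2, fun h => ⟨noLooseChunksF_2695_of_sphereCovering hFT, h⟩⟩

/-- g33's top piece re-based EXACTLY (modulo the fact): `BandExclusionF 2 (11/4) ↔ BandExclusionF 2 (27/10)` (both are `NLC_F(2)`). -/
theorem bandExclusionF_two_11_4_iff_27_10_of_sphereCovering (hFT : FejesToth1943_sphereCovering) :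
    BandExclusionF 2 (11 / 4) ↔ BandExclusionF 2 (27 / 10) := by
  rw [← noLooseChunksF_two_iff_band_of_sphereCovering hFT, noLooseChunksF_two_iff_band27_of_sphereCovering hFT]

/-- EXACT sub-split of g33's top piece on the grid `2 < 27/10 < 11/4` (unconditional direction of use: the second factor is the new
Fejes Tóth sub-band): `BandExclusionF 2 (11/4) ∧ BandExclusionF (27/10) (11/4) → …` is not needed — modulo the fact BOTH
`BandExclusionF (27/10) (11/4)` (a theorem, `bandExclusionF_27_10_of_sphereCovering`) and the equivalence above hold; recorded as the pair. -/
theorem bandExclusionF_two_11_4_split_of_sphereCovering (hFT : FejesToth1943_sphereCovering) :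
    BandExclusionF 2 (11 / 4) ↔ BandExclusionF 2 (27 / 10) ∧ BandExclusionF (27 / 10) (11 / 4) :=
  ⟨fun h => ⟨(bandExclusionF_two_11_4_iff_27_10_of_sphereCovering hFT).1 h, bandExclusionF_27_10_of_sphereCovering hFT _⟩,
    fun h => (bandExclusionF_two_11_4_iff_27_10_of_sphereCovering hFT).2 h.1⟩

/-! ### §46.5 The single-sphere covering method is EXHAUSTED here (numbers, for the record)
`BallCoveringBound 11 ρ` via Fejes Tóth needs `cos² ω₁₁ < 3(ρ²−1)/(4ρ²−3)`, i.e. `ρ > ρ_FT = 1.58396…` (`δ > δ_FT = 2.6914…`); via the TRUE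
thinnest 11-cap covering (`θ₁₁ ≈ 41.4°`, numerical, Tarnai–Gáspár; census TAG 156: `41.55–41.59°` by 160-start descent) it could reach
`ρ > 1/sin θ₁₁ ≈ 1.51`, `δ ≈ 2.59` — but only with a CERTIFIED `θ₁₁` (interval branch-and-bound over eleven cap centres; census TAG 165
«CAP11-CERT», optional); and NO covering argument crosses `δ_geo ≥ 2.474`: the census's explicit `7/10`-separated periodic set with covering
radius `< 1` has a site with only eleven others within `2.432 = (1 + 2.474)·(7/10)` (GEO156, witness npz).  Below `δ_geo` the band is
ENERGETIC-only. -/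

end Summit.AtomisticToContinuum.Crystallization.Theorems.ContactSaturationLadderCoveringRungSharp

end
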